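import Summits.QuantumFields.YangMills.Theorems.BalabanUVNodesN22W1DerivBound
import Literature.MathematicalPhysics.QuantumFieldTheory.Balaban1983to89.Node00.RateRecordW1Reading
import Literature.Analysis.Complex.HolomorphicBanach

/-!
# BalabanUVNodes ∕ N18 — THE H-LAYER ACTIVITY DATUM IN THE CONFIGURATION DIRECTION ON THE OBJECTS OF RECORD: [II] p. 15 «the
# activities in (2.13), and the whole sum E^{(k+1)}(X), are analytic functions of (𝐔, 𝐉) on U^c_{k+1}(X, α₀, α₁)» + (2.39)–(2.41) p. 21
# AT W1's ONE-STEP CLUSTER DATA `Node00.W1.ClusterStep` ∕ tower `W1.ClusterTower` (p455641) and AT THE W1 READING's level pairing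
# `Node00.W1.LevelPairing` (p465810): per step `AnalyticH` + `Bound238` ⟹ `E^{(k+1)}(X; g; ·)` analytic on the space AND (2.41)-bounded;
# on the tower `W1.TermAnalytic` ([I] p. 263) + `W1.TermBound118` ((1.18)); hence n22-c's `TermDerivBound` ((1.17)) with both its displayed
# inputs manufactured, and `T4OutputRate.DecayBound` of the reading's `EA` ∕ `EB` = NE5's leaves L05 ∕ L06 at the reading
# (Track A, DAG node N18 = NE5 `T4OutputRate.NE5 EA EB W κ θ C₅` :211; cluster K4 «SpineRates»; file 9 of seat pub-ymgap-dag-n18-c, row s1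
# «the H-layer ACTIVITY DATUM … instance + estimate», generation 3)

Cell `pub-ymgap`, HUMAN RULING D-0062 (Track A), R134 ACCELERATION seat `pub-ymgap-dag-n18-c` (strategy s1), generation 3.  THEOREMS ONLY
(no `def`, no `instance`, no `sorry`); imports n22-c's `Thm/BalabanUVNodesN22W1DerivBound` (p468034; through it `…N22W1StripInduction` and the
NE1′ faces `Spine/NE1p/DressedOutputAnalyticFaces`), definer W1's reading `Node00/RateRecordW1Reading` (p465810; through it the W1 OBJECT
`Node00/HistoryTermsOfRecord` p455641) and `Literature/Analysis/Complex/HolomorphicBanach` ([Chae1985] Thm 14.13); restates nothing.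

WHY (the row, at the objects of record).  Row s1 of N18 is «the H-LAYER ACTIVITY DATUM on the record's torus catalogue (what
`ne5_of_leaves_activities` consumes): instance + estimate».  Generations 0–2 (files 1–8, p450706 … p465643) instanced route P1's datum `hH` of
`Spine/NE5/EnvelopeOnRecord` in the STEP-DATA direction (`Op × Hist`) and reduced it by name to NODE O's walk records.  Since then NODE 00's
definer W1 landed THE OBJECTS OF RECORD the N18 ∕ N22 faces are keyed to: the one-step cluster data `S : W1.ClusterStep P 𝔸 M k` of [II] §2
(activity `S.H g φ Z` (2.9)∕(2.11); `S.E g φ X :=` (2.13) AS A DEFINITION, `B13Resummation.locE` on `tgeometry P.d (domCount P M (k+1))`,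
`ClusterStep.E_eq_locE` by `rfl`), the tower `W1.ClusterTower` with terms `W1.termC S j X g φ = E^{(j)}(X; g₀,…,g_{j−1}; φ)`, the NAMED step
predicates `ClusterStep.AnalyticH Wk sp` ((2.13an) p. 15) and `ClusterStep.Bound238 Wk sp A r` (Lemma 3 (2.38) p. 20), the NAMED tower predicates
`W1.TermAnalytic` ([I] p. 263 «E^{(j)}(X, …) is defined and analytic on the space U^c_j(X, α₀, α₁)»), `W1.TermBound118` ((1.18) ∕ (2.41)),
`W1.TermDerivBound` ((1.17)), the restriction property `W1.SpRestr` (p. 15) — all «asserted nowhere» — and the W1 READING `W1.LevelPairing.EA ∕ EB`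
(the objects `T4OutputRate.NE5` is stated on at the rate-record home).  In THIS currency the H-layer activity datum is the pair (`AnalyticH`,
`Bound238`) IN THE CONFIGURATION DIRECTION `φ ∈ Φ = Sect2.CPair P 𝔸`, and its ESTIMATE is the passage [II] p. 15 + (2.39)–(2.41) p. 21 from the
activities to `E^{(k+1)}` ([KP86] convergence of the cluster expansion uniformly on the space).  The tree had this passage for an abstract PARAMETER
(NE1′ `DressedOutputAnalyticFaces.analytic_and_bounded_locE_param_of_geometry`, used by route P1 at `Op × Hist` and by n22-c at the complexified
coupling `z ∈ ℂ`) but NOT at the configuration itself: `W1.ClusterStep.AnalyticH` had no consumer, and `W1.TermAnalytic` entered n22-c's (1.17) face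
`YMDAG.N22.W1.termDerivBound_of_termBound118` as a DISPLAYED hypothesis («print's inductive analyticity, by assertion»).  This file supplies it.

WHAT (theorems only; `open Classical` instances exactly as in W1's `ClusterStep.E` and n22-c's strip files, so (2.13) is matched by `rfl`).
* §1 `analyticOnNhd_and_bound_E_of_bound238` — ONE STEP, ANY torus `P : Params`: for `S : W1.ClusterStep P 𝔸 M k`, a young-coupling set `Wk`, a
  space table `sp` on `𝐃_{k+1}` with every `sp X` OPEN and the restriction property `W1.SpRestr sp`, the data `S.AnalyticH Wk sp` + `S.Bound238 Wk sp A R`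
  and the two one-run clauses in the constants of the torus polymer geometry `G = tgeometry P.d (domCount P M (k+1))` (`r₁ + 2G.κ₀ + 2 ≤ R`,
  `A·e^{5r₁+1}·G.K₀·G.ν·G.c₁ ≤ 1`; by `TreeLengthTorusGeometry.tgeometry_consts` these are `ν = 2d+1`, `κ₀ = κ₀(4·2^d, 2d)`, `K₀ = K₀(4·2^d, 2d)`,
  `c₁ = 4·2^d` — functions of `d` alone, hence UNIFORM IN THE STEP) ⟹ for every `g ∈ Wk` and `X ∈ 𝐃_{k+1}`: `AnalyticOnNhd ℂ (φ ↦ S.E g φ X) (sp X)`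
  AND `‖S.E g φ X‖ ≤ e·G.ν·G.c₁·G.K₀²·A·e^{−r₁ d_{k+1}(X)}` on `sp X`.  Proof: the NE1′ face at parameter space `Φ` itself, open set `sp X`,
  activities `φ ↦ S.H g φ Z` (holomorphic on `sp Z ⊇ sp X` for `Z ⊆ X` by `SpRestr`, dominated there by (2.38)), then [Chae1985].
* §2 THE TOWER, ANY `P`: `termAnalytic_of_bound238` (`W1.TermAnalytic S W sp`) and `termBound118_of_bound238` (`W1.TermBound118 S W sp
  (e·(2d+1)·(4·2^d)·K₀(4·2^d,2d)²·A) r₁`) from the per-step data at young-coupling sets `Wk k ∋` the prefixes of `W` (level 0: no term, [I] (0.23));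
  `termBound118_mono` (amplitude renewal `E₀ ≤ E₀′`, print's «O(1)C₃ε₁ ≤ E₀»).
* §3 AT THE RECORD's TORI `F.P K` (d = 4), LOCATED NUMERALS of the NE1′ faces (`r₁ + 2·64·log 162 + 2 ≤ R`, `A·e^{5r₁+1}·K₀(64,8)·9·64 ≤ 1`,
  `E₀ = e·9·64·K₀(64,8)²·A`, n22-c's format): `analyticOnNhd_and_bound_E_of_bound238_four`, `termAnalytic_of_bound238_four`, `termBound118_of_bound238_four`.
* §4 INTO n22-c's FACES BY NAME: `termDerivBound_of_bound238_four` = `YMDAG.N22.W1.termDerivBound_of_termBound118` with BOTH displayed inputs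
  (`han : TermAnalytic`, `h118 : TermBound118`) MANUFACTURED from the H-layer datum — (1.17) `‖E′‖ ≤ (E₀∕ρ)e^{−r₁ d_j(X)}` on a margin-`ρ` sub-table;
  `decayBound_functionalOn_of_bound238_four` = `YMDAG.N22.W1.decayBound_functionalOn_of_termBound118` likewise — `T4OutputRate.DecayBound
  (W1.functionalOn S p emb) (Window γ) E₀ r₁` for readings inside the spaces.
* §5 AT THE W1 READING's LEVEL PAIRING `R : W1.LevelPairing F 𝔸 M k` (run A on `F.P k`, run B on `F.P (k+1)`): `prependCoupling_mem_window`;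
  `decayBound_EA_of_bound238` — `DecayBound (R.EA S) (Window γ) E₀ r₁` from the H-layer data of run A's tower `S` on a table `sp` holding the
  readings `R.embA U`; `decayBound_EB_of_bound238` — `DecayBound (R.EB S′ b) (Window γ) E₀ r₁` for every `b ∈ ]0, γ]` from the H-layer data of run
  B's tower `S′` on a table `sp′` (on `F.P (k+1)`) holding the readings `R.embB U`, with the UNPRINTED pairing datum «`pair` does not shrink the
  linear size: `d_j(X) ≤ d(pair X)`» DISPLAYED (`hpair`; the record intends equal physical extent, [I] (0.24)–(0.25)).  These two ARE NE5's leaves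
  L05 ∕ L06 (`Spine/NE5/LeafIndex.L05 ∕ L06`, `abbrev`s of `DecayBound`) at the reading's functionals — the inputs `N18End` ∕ `EnvelopeOnRecord` ∕
  N19's `…N19LipBracketTube` read as `DecayBound EA W E₀ κ`.
* §6 A5 rider (non-vacuity of the hypotheses; junk witness labelled so): `analyticH_termlessTower`, `bound238_termlessTower` — W1's termless tower
  (`H ≡ 0`, `RateRecordW1Reading` §6) carries the H-layer data for every `A ≥ 0`; the open-table ∕ restriction hypotheses are met by `sp := univ`.

HONEST FRAMING — what this is NOT.  Count-neutral kernel bookkeeping BY NAME ([KP86] through the NE1′ face, [Chae1985] through `HolomorphicBanach`);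
NOT a discharge of N18 (typed 28∕28 · discharged 5∕27 UNCHANGED).  The per-step data `AnalyticH` ∕ `Bound238` are W1's named HYPOTHESES — [II]
(2.13an) p. 15 and Lemma 3 (2.38) p. 20 for THE (2.14) terms of record, i.e. N10's Lemmas 1–3 ∕ NODE A's majorant on the class (1.5) ∕ NODE O's
objects; asserted nowhere, instanced by nobody (the towers `S` are RESIDUAL data of the reading, ref-H WATCH-W1-DEGENERATE: §6's witness is the junk
termless tower).  The space tables `sp` (openness, restriction property) and the readings `embA ∕ embB` landing inside them are DISPLAYED ([I] p. 263
«the configurations … restricted to X belong to U^c_j» is Theorem-1 content; `W1.spaceOfRecord` is not proved open here).  NE5 itself (the η-RATE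
`θ₅ < 1` comparison of the two runs) is NOT touched: one-run envelopes give L05∕L06, not the rate (`N18AtRecord.not_n18At_unit_gap`; the reading's
`LetterInputs.signs_analytic` pins `0 < θ₅ < 1`).  NE5 NOT IN PRINT ([I] Thm 1 p. 259), NOT PROVED.  One finite four-torus programme at fixed `ε`,
Bałaban as printed — NOT the continuum limit on ℝ⁴, NOT infinite volume, NOT OS, NOT a mass gap, NOT Clay.  0 `sorry`, 0 `def`; axioms standard.

References (TYPES ∕ loci only, via the imported `[cite:]`-tagged modules): [I] = [Balaban1987RG1] CMP **109** (1987) 249–301 — (0.23) p. 256,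
(0.24)–(0.25) p. 257, Thm 1 p. 259, (1.17)–(1.18) + the analyticity sentence p. 263; [II] = [Balaban1988RG2Cluster] CMP **116** (1988) 1–22 —
(2.9)–(2.14) pp. 14–15 (with the analyticity statement p. 15), Lemma 3 (2.38) p. 20, (2.39)–(2.41) p. 21; [KoteckyPreiss1986] CMP **103** (1986)
Thm p. 492; [Chae1985] S. B. Chae, *Holomorphy and Calculus in Normed Spaces* (Dekker 1985), Thm 14.13.
-/

noncomputable section

namespace Summit.QuantumFields.YangMills.BalabanUVNodes.N18HLayerW1Config

open Set Metric
open scoped BigOperators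
open Literature.MathematicalPhysics.QuantumFieldTheory.Balaban1983to89
open Literature.MathematicalPhysics.QuantumFieldTheory.Balaban1983to89.T4Continuum (T4Family)
open Literature.MathematicalPhysics.QuantumFieldTheory.Balaban1983to89.T4OutputRate
open Literature.MathematicalPhysics.QuantumFieldTheory.Balaban1983to89.B13Resummation (locE)
open Literature.MathematicalPhysics.QuantumFieldTheory.Balaban1983to89.TreeLengthTorus (TPt TDom tsys torusTreeLen torusTreeLen_nonneg)
open Literature.MathematicalPhysics.QuantumFieldTheory.Balaban1983to89.TreeLengthTorusGeometry (TTouch tgeometry tgeometry_consts)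
open Literature.MathematicalPhysics.QuantumFieldTheory.Balaban1983to89.B12TreeDecay (K₀ K₀_pos kappa₀)
open Literature.MathematicalPhysics.QuantumFieldTheory.Balaban1983to89.Node00
open Literature.MathematicalPhysics.QuantumFieldTheory.Balaban1983to89.Node00.Sect2 (domSys domCount CPair)
open Literature.MathematicalPhysics.QuantumFieldTheory.Balaban1983to89.Node00.W1
open Summit.QuantumFields.BalabanUV.T4Continuum.NE1p.DressedOutputAnalyticFaces (analytic_and_bounded_locE_param_of_geometry)
open Literature.Analysis.Complex.HolomorphicBanach (analyticOnNhd_of_differentiableOn)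
open YMDAG.N22.W1 (termDerivBound_of_termBound118 decayBound_functionalOn_of_termBound118)

/-! ## §1 ONE STEP, ANY TORUS: (2.13an) + (2.38) for `H` on the space ⟹ `E^{(k+1)}(X; g; ·)` analytic on `U^c_{k+1}(X)` and (2.41)-bounded -/

section Step

variable {P : Params} {𝔸 : Type*} [NormedRing 𝔸] [NormedAlgebra ℂ 𝔸] {M k : ℕ}

open Classical in
/-- **[II] p. 15 + (2.39)–(2.41) p. 21 AT THE ONE-STEP CLUSTER DATA OF RECORD, IN THE CONFIGURATION DIRECTION.**  For W1's one-step data `S` at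
step `k` on the torus `P`, a young-coupling set `Wk` and a space table `sp` on `𝐃_{k+1}` of record whose members are OPEN (`hsp`) and which has
the restriction property of p. 15 (`hrestr : W1.SpRestr sp` — a configuration of the space on `X` lies in the space on every `Z ⊂ X`): IF the
activities are analytic on the spaces (`han : S.AnalyticH Wk sp`, (2.13an)) and obey Lemma 3's bound there (`h238 : S.Bound238 Wk sp A R`, (2.38)
with amplitude `A ≥ 0` — print `C₃ε₁` — and rate `R` — print `(1−8δ)½Lκ`), and the two one-run clauses hold in the constants of the torus
polymer geometry `G = tgeometry P.d (domCount P M (k+1))` of `𝐃_{k+1}` (`r₁ + 2G.κ₀ + 2 ≤ R`, `A·e^{5r₁+1}·G.K₀·G.ν·G.c₁ ≤ 1`; (2.39)–(2.40)-type),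
THEN for every `g ∈ Wk` and `X ∈ 𝐃_{k+1}`: `E^{(k+1)}(X; g; ·) = S.E g · X` ((2.13), definitional) is ANALYTIC on `sp X` («the whole sum E^{(k+1)}(X)
[is an] analytic function of (𝐔,𝐉) on U^c_{k+1}(X, α₀, α₁)») AND `‖S.E g φ X‖ ≤ e·G.ν·G.c₁·G.K₀²·A·e^{−r₁ d_{k+1}(X)}` for `φ ∈ sp X` ((2.41)).
Proof: NE1′ `analytic_and_bounded_locE_param_of_geometry` at parameter space `Φ = CPair P 𝔸` and open set `sp X` (activities `φ ↦ S.H g φ Z`,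
`Z ⊆ X`, holomorphic on `sp Z ⊇ sp X` and dominated there), then [Chae1985] Thm 14.13 (`HolomorphicBanach.analyticOnNhd_of_differentiableOn`).
[folklore] -/
theorem analyticOnNhd_and_bound_E_of_bound238 (S : ClusterStep P 𝔸 M k) (Wk : Set (Fin (k + 1) → ℝ))
    (sp : (domSys P M (k + 1)).Dom → Set (CPair P 𝔸)) {A R r₁ : ℝ} (hsp : ∀ X, IsOpen (sp X)) (hrestr : W1.SpRestr sp)
    (han : S.AnalyticH Wk sp) (h238 : S.Bound238 Wk sp A R) (hA : 0 ≤ A) (hr₁ : 0 ≤ r₁)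
    (hrate : r₁ + 2 * (tgeometry P.d (domCount P M (k + 1))).κ₀ + 2 ≤ R)
    (hsmall : A * Real.exp (5 * r₁ + 1) * (tgeometry P.d (domCount P M (k + 1))).K₀ * (tgeometry P.d (domCount P M (k + 1))).ν *
      (tgeometry P.d (domCount P M (k + 1))).c₁ ≤ 1) :
    ∀ g ∈ Wk, ∀ X : (domSys P M (k + 1)).Dom,
      AnalyticOnNhd ℂ (fun φ => S.E g φ X) (sp X) ∧
        ∀ φ ∈ sp X, ‖S.E g φ X‖ ≤
          Real.exp 1 * (tgeometry P.d (domCount P M (k + 1))).ν * (tgeometry P.d (domCount P M (k + 1))).c₁ *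
            (tgeometry P.d (domCount P M (k + 1))).K₀ ^ 2 * A * Real.exp (-(r₁ * (domSys P M (k + 1)).dj X)) := by
  intro g hg X
  have key := analytic_and_bounded_locE_param_of_geometry (tgeometry P.d (domCount P M (k + 1)))
    (m := fun Z : (domSys P M (k + 1)).Dom => A * Real.exp (-(R * (domSys P M (k + 1)).dj Z)))
    (act := fun (φ : CPair P 𝔸) (Z : (domSys P M (k + 1)).Dom) => S.H g φ Z) (A := A) (R := R) (r₁ := r₁) X (hsp X) hA hr₁
    hrate hsmall (fun Z hZ => ((han g hg Z).differentiableOn).mono (hrestr X Z hZ))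
    (fun φ hφ Z hZ => h238 g hg Z φ (hrestr X Z hZ hφ)) (fun Z _ => le_rfl)
  exact ⟨analyticOnNhd_of_differentiableOn key.1 (hsp X), key.2⟩

end Step

/-! ## §2 THE TOWER, ANY TORUS: per-step H-layer data ⟹ `W1.TermAnalytic` ([I] p. 263) and `W1.TermBound118` ((1.18)) -/

section Tower

variable {P : Params} {𝔸 : Type*} [NormedRing 𝔸] [NormedAlgebra ℂ 𝔸] {M : ℕ}

open Classical in
/-- **[I] p. 263 «E^{(j)}(X, g_{j−1}, 𝐔, 𝐉) is defined and analytic on the space U^c_j(X, α₀, α₁)» FROM THE H-LAYER DATA OF EVERY STEP.**  For W1's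
tower `S` on the torus `P`, a history set `W` whose young-coupling prefixes lie in the sets `Wk k` (`hW`; e.g. `W = Window γ`, `Wk k = box γ k` by
`W1.restrictPrefix_mem_box`), and a space table `sp` with `sp (k+1) X` open and the restriction property at every positive level: per-step
analyticity `(S k).AnalyticH (Wk k) (sp (k+1))` and (2.38) `(S k).Bound238 (Wk k) (sp (k+1)) A R`, with the two clauses written in the STEP-UNIFORM
constants of the torus geometry (`TreeLengthTorusGeometry.tgeometry_consts`: `κ₀ = κ₀(4·2^d, 2d)`, `K₀ = K₀(4·2^d, 2d)`, `ν = 2d+1`, `c₁ = 4·2^d`)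
⟹ `W1.TermAnalytic S W sp` (level 0 has no term, [I] (0.23); level `k+1` is §1 at the prefix). [folklore] -/
theorem termAnalytic_of_bound238 (S : ClusterTower P 𝔸 M) (W : Set (ℕ → ℝ)) (Wk : (k : ℕ) → Set (Fin (k + 1) → ℝ))
    (sp : (j : ℕ) → (domSys P M j).Dom → Set (CPair P 𝔸)) {A R r₁ : ℝ} (hW : ∀ k, ∀ g ∈ W, restrictPrefix k g ∈ Wk k)
    (hsp : ∀ (k : ℕ) (X : (domSys P M (k + 1)).Dom), IsOpen (sp (k + 1) X)) (hrestr : ∀ k, W1.SpRestr (sp (k + 1)))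
    (han : ∀ k, (S k).AnalyticH (Wk k) (sp (k + 1))) (h238 : ∀ k, (S k).Bound238 (Wk k) (sp (k + 1)) A R) (hA : 0 ≤ A)
    (hr₁ : 0 ≤ r₁) (hrate : r₁ + 2 * kappa₀ (4 * 2 ^ P.d) (2 * P.d) + 2 ≤ R)
    (hsmall : A * Real.exp (5 * r₁ + 1) * K₀ (4 * 2 ^ P.d) (2 * P.d) * (2 * (P.d : ℝ) + 1) * (4 * 2 ^ P.d) ≤ 1) :
    TermAnalytic S W sp := by
  intro g hg j X
  cases j with
  | zero => exact analyticOnNhd_const -- no term is created before the first step: `termC S 0 X g = 0`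
  | succ k =>
    obtain ⟨hν, hκ₀, hK₀, hc₁⟩ := tgeometry_consts P.d (domCount P M (k + 1))
    have h := analyticOnNhd_and_bound_E_of_bound238 (S k) (Wk k) (sp (k + 1)) (hsp k) (hrestr k) (han k) (h238 k) hA hr₁
      (by rw [hκ₀]; exact hrate) (by rw [hK₀, hν, hc₁]; exact hsmall) (restrictPrefix k g) (hW k g hg) X
    exact h.1

open Classical in
/-- **[I] (1.18) ∕ [II] (2.41) FROM THE H-LAYER DATA OF EVERY STEP**: under the hypotheses of `termAnalytic_of_bound238`,
`W1.TermBound118 S W sp (e·(2d+1)·(4·2^d)·K₀(4·2^d, 2d)²·A) r₁` — `‖E^{(j)}(X; g; φ)‖ ≤ E₀·e^{−r₁ d_j(X)}` on `sp j X` for every history of `W`, with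
`E₀ = e·ν·c₁·K₀²·A` the (2.41) amplitude (print: `O(1)C₃ε₁`). [folklore] -/
theorem termBound118_of_bound238 (S : ClusterTower P 𝔸 M) (W : Set (ℕ → ℝ)) (Wk : (k : ℕ) → Set (Fin (k + 1) → ℝ))
    (sp : (j : ℕ) → (domSys P M j).Dom → Set (CPair P 𝔸)) {A R r₁ : ℝ} (hW : ∀ k, ∀ g ∈ W, restrictPrefix k g ∈ Wk k)
    (hsp : ∀ (k : ℕ) (X : (domSys P M (k + 1)).Dom), IsOpen (sp (k + 1) X)) (hrestr : ∀ k, W1.SpRestr (sp (k + 1)))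
    (han : ∀ k, (S k).AnalyticH (Wk k) (sp (k + 1))) (h238 : ∀ k, (S k).Bound238 (Wk k) (sp (k + 1)) A R) (hA : 0 ≤ A)
    (hr₁ : 0 ≤ r₁) (hrate : r₁ + 2 * kappa₀ (4 * 2 ^ P.d) (2 * P.d) + 2 ≤ R)
    (hsmall : A * Real.exp (5 * r₁ + 1) * K₀ (4 * 2 ^ P.d) (2 * P.d) * (2 * (P.d : ℝ) + 1) * (4 * 2 ^ P.d) ≤ 1) :
    TermBound118 S W sp (Real.exp 1 * (2 * (P.d : ℝ) + 1) * (4 * 2 ^ P.d) * K₀ (4 * 2 ^ P.d) (2 * P.d) ^ 2 * A) r₁ := by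
  intro g hg j X φ hφ
  cases j with
  | zero =>
    have h0 : ‖termC S 0 X g φ‖ = 0 := by rw [termC_zero, norm_zero]
    rw [h0]
    positivity
  | succ k =>
    obtain ⟨hν, hκ₀, hK₀, hc₁⟩ := tgeometry_consts P.d (domCount P M (k + 1))
    have h := analyticOnNhd_and_bound_E_of_bound238 (S k) (Wk k) (sp (k + 1)) (hsp k) (hrestr k) (han k) (h238 k) hA hr₁
      (by rw [hκ₀]; exact hrate) (by rw [hK₀, hν, hc₁]; exact hsmall) (restrictPrefix k g) (hW k g hg) X
    have h' := h.2 φ hφ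
    rw [hν, hc₁, hK₀] at h'
    exact h'

omit [NormedRing 𝔸] [NormedAlgebra ℂ 𝔸] in
/-- **AMPLITUDE RENEWAL** (print, [II] p. 21–22: «O(1)C₃ε₁ ≤ E₀» closes the induction): `W1.TermBound118` is monotone in the amplitude. [folklore] -/
theorem termBound118_mono (S : ClusterTower P 𝔸 M) (W : Set (ℕ → ℝ)) (sp : (j : ℕ) → (domSys P M j).Dom → Set (CPair P 𝔸))
    {E₀ E₀' r : ℝ} (hE : E₀ ≤ E₀') (h : TermBound118 S W sp E₀ r) : TermBound118 S W sp E₀' r :=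
  fun g hg j X φ hφ => (h g hg j X φ hφ).trans (mul_le_mul_of_nonneg_right hE (Real.exp_nonneg _))

end Tower

/-! ## §3 AT THE RECORD's TORI `F.P K` (d = 4): the located numerals `ν = 9`, `c₁ = 64`, `K₀ = K₀(64,8)`, `κ₀ = 64·log 162` -/

section Four

variable (F : T4Family) (K : ℕ) {𝔸 : Type*} [NormedRing 𝔸] [NormedAlgebra ℂ 𝔸] {M : ℕ}

/-- The torus geometry of `𝐃_{k+1}(F.P K)` has the d = 4 constants `ν = 9`, `κ₀ = 64·log 162`, `K₀ = K₀(64, 8)`, `c₁ = 64`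
(`TreeLengthTorusGeometry.tgeometry_consts_four` ∕ `tgeometry_consts`; `(F.P K).d = 4` by `rfl`). [folklore] -/
theorem tgeometry_consts_FP (k : ℕ) :
    (tgeometry (F.P K).d (domCount (F.P K) M (k + 1))).ν = 9 ∧
      (tgeometry (F.P K).d (domCount (F.P K) M (k + 1))).κ₀ = 64 * Real.log 162 ∧
      (tgeometry (F.P K).d (domCount (F.P K) M (k + 1))).K₀ = K₀ 64 8 ∧
      (tgeometry (F.P K).d (domCount (F.P K) M (k + 1))).c₁ = 64 := by
  obtain ⟨hν, hκ₀, hc₁⟩ := TreeLengthTorusGeometry.tgeometry_consts_four (domCount (F.P K) M (k + 1))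
  refine ⟨hν, hκ₀, ?_, hc₁⟩
  show K₀ (4 * 2 ^ 4) (2 * 4) = K₀ 64 8
  norm_num

open Classical in
/-- **§1 AT `F.P K` WITH THE LOCATED NUMERALS**: per step, `AnalyticH` + `Bound238` + open spaces with the restriction property + `r₁ + 2·64·log 162
+ 2 ≤ R` + `A·e^{5r₁+1}·K₀(64,8)·9·64 ≤ 1` ⟹ `E^{(k+1)}(X; g; ·)` analytic on `sp X` and `‖·‖ ≤ e·9·64·K₀(64,8)²·A·e^{−r₁ d_{k+1}(X)}` there
(n22-c's numeral format, `…N22W1StripInduction.strip_succ_of_complexifiedTerms`). [folklore] -/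
theorem analyticOnNhd_and_bound_E_of_bound238_four {k : ℕ} (S : ClusterStep (F.P K) 𝔸 M k) (Wk : Set (Fin (k + 1) → ℝ))
    (sp : (domSys (F.P K) M (k + 1)).Dom → Set (CPair (F.P K) 𝔸)) {A R r₁ : ℝ} (hsp : ∀ X, IsOpen (sp X))
    (hrestr : W1.SpRestr sp) (han : S.AnalyticH Wk sp) (h238 : S.Bound238 Wk sp A R) (hA : 0 ≤ A) (hr₁ : 0 ≤ r₁)
    (hrate : r₁ + 2 * (64 * Real.log 162) + 2 ≤ R) (hsmall : A * Real.exp (5 * r₁ + 1) * K₀ 64 8 * 9 * 64 ≤ 1) :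
    ∀ g ∈ Wk, ∀ X : (domSys (F.P K) M (k + 1)).Dom,
      AnalyticOnNhd ℂ (fun φ => S.E g φ X) (sp X) ∧
        ∀ φ ∈ sp X, ‖S.E g φ X‖ ≤ Real.exp 1 * 9 * 64 * K₀ 64 8 ^ 2 * A * Real.exp (-(r₁ * (domSys (F.P K) M (k + 1)).dj X)) := by
  obtain ⟨hν, hκ₀, hK₀, hc₁⟩ := tgeometry_consts_FP F K (M := M) k
  have h := analyticOnNhd_and_bound_E_of_bound238 S Wk sp hsp hrestr han h238 hA hr₁ (by rw [hκ₀]; exact hrate)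
    (by rw [hK₀, hν, hc₁]; exact hsmall)
  rw [hν, hc₁, hK₀] at h
  exact h

open Classical in
/-- **`W1.TermAnalytic` AT `F.P K` FROM THE H-LAYER DATA OF EVERY STEP** ([I] p. 263), located numerals. [folklore] -/
theorem termAnalytic_of_bound238_four (S : ClusterTower (F.P K) 𝔸 M) (W : Set (ℕ → ℝ)) (Wk : (k : ℕ) → Set (Fin (k + 1) → ℝ))
    (sp : (j : ℕ) → (domSys (F.P K) M j).Dom → Set (CPair (F.P K) 𝔸)) {A R r₁ : ℝ} (hW : ∀ k, ∀ g ∈ W, restrictPrefix k g ∈ Wk k)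
    (hsp : ∀ (k : ℕ) (X : (domSys (F.P K) M (k + 1)).Dom), IsOpen (sp (k + 1) X)) (hrestr : ∀ k, W1.SpRestr (sp (k + 1)))
    (han : ∀ k, (S k).AnalyticH (Wk k) (sp (k + 1))) (h238 : ∀ k, (S k).Bound238 (Wk k) (sp (k + 1)) A R) (hA : 0 ≤ A)
    (hr₁ : 0 ≤ r₁) (hrate : r₁ + 2 * (64 * Real.log 162) + 2 ≤ R) (hsmall : A * Real.exp (5 * r₁ + 1) * K₀ 64 8 * 9 * 64 ≤ 1) :
    TermAnalytic S W sp := by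
  intro g hg j X
  cases j with
  | zero => exact analyticOnNhd_const
  | succ k =>
    exact (analyticOnNhd_and_bound_E_of_bound238_four F K (S k) (Wk k) (sp (k + 1)) (hsp k) (hrestr k) (han k) (h238 k) hA hr₁
      hrate hsmall (restrictPrefix k g) (hW k g hg) X).1

open Classical in
/-- **`W1.TermBound118` — (1.18) — AT `F.P K` FROM THE H-LAYER DATA OF EVERY STEP**, amplitude `E₀ = e·9·64·K₀(64,8)²·A`, rate `r₁`. [folklore] -/
theorem termBound118_of_bound238_four (S : ClusterTower (F.P K) 𝔸 M) (W : Set (ℕ → ℝ)) (Wk : (k : ℕ) → Set (Fin (k + 1) → ℝ))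
    (sp : (j : ℕ) → (domSys (F.P K) M j).Dom → Set (CPair (F.P K) 𝔸)) {A R r₁ : ℝ} (hW : ∀ k, ∀ g ∈ W, restrictPrefix k g ∈ Wk k)
    (hsp : ∀ (k : ℕ) (X : (domSys (F.P K) M (k + 1)).Dom), IsOpen (sp (k + 1) X)) (hrestr : ∀ k, W1.SpRestr (sp (k + 1)))
    (han : ∀ k, (S k).AnalyticH (Wk k) (sp (k + 1))) (h238 : ∀ k, (S k).Bound238 (Wk k) (sp (k + 1)) A R) (hA : 0 ≤ A)
    (hr₁ : 0 ≤ r₁) (hrate : r₁ + 2 * (64 * Real.log 162) + 2 ≤ R) (hsmall : A * Real.exp (5 * r₁ + 1) * K₀ 64 8 * 9 * 64 ≤ 1) :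
    TermBound118 S W sp (Real.exp 1 * 9 * 64 * K₀ 64 8 ^ 2 * A) r₁ := by
  intro g hg j X φ hφ
  cases j with
  | zero =>
    have h0 : ‖termC S 0 X g φ‖ = 0 := by rw [termC_zero, norm_zero]
    rw [h0]
    positivity
  | succ k =>
    exact (analyticOnNhd_and_bound_E_of_bound238_four F K (S k) (Wk k) (sp (k + 1)) (hsp k) (hrestr k) (han k) (h238 k) hA hr₁
      hrate hsmall (restrictPrefix k g) (hW k g hg) X).2 φ hφ

end Four

/-! ## §4 INTO n22-c's FACES BY NAME: (1.17) `TermDerivBound` and `DecayBound` of `functionalOn` with their displayed inputs manufactured -/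

section IntoN22

variable (F : T4Family) (K : ℕ) {𝔸 : Type*} [NormedRing 𝔸] [NormedAlgebra ℂ 𝔸] {M : ℕ}

open Classical in
/-- **(1.17) `‖E′‖` FROM THE H-LAYER DATUM** ([I] p. 263): n22-c's `YMDAG.N22.W1.termDerivBound_of_termBound118` — margin `ρ` of the sub-table `sp′`
inside `sp` + `TermAnalytic` + `TermBound118` ⟹ `W1.TermDerivBound S W sp′ (E₀∕ρ) r₁` — with BOTH analytic inputs produced by §3 from the per-step data
`AnalyticH` + `Bound238`; `E₀ = e·9·64·K₀(64,8)²·A`. [folklore] -/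
theorem termDerivBound_of_bound238_four (S : ClusterTower (F.P K) 𝔸 M) (W : Set (ℕ → ℝ)) (Wk : (k : ℕ) → Set (Fin (k + 1) → ℝ))
    (sp sp' : (j : ℕ) → (domSys (F.P K) M j).Dom → Set (CPair (F.P K) 𝔸)) {A R r₁ ρ : ℝ} (hρ : 0 < ρ)
    (hmargin : ∀ (j : ℕ) (X : (domSys (F.P K) M j).Dom), ∀ φ ∈ sp' j X, ball φ ρ ⊆ sp j X)
    (hW : ∀ k, ∀ g ∈ W, restrictPrefix k g ∈ Wk k) (hsp : ∀ (k : ℕ) (X : (domSys (F.P K) M (k + 1)).Dom), IsOpen (sp (k + 1) X))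
    (hrestr : ∀ k, W1.SpRestr (sp (k + 1))) (han : ∀ k, (S k).AnalyticH (Wk k) (sp (k + 1)))
    (h238 : ∀ k, (S k).Bound238 (Wk k) (sp (k + 1)) A R) (hA : 0 ≤ A) (hr₁ : 0 ≤ r₁) (hrate : r₁ + 2 * (64 * Real.log 162) + 2 ≤ R)
    (hsmall : A * Real.exp (5 * r₁ + 1) * K₀ 64 8 * 9 * 64 ≤ 1) :
    TermDerivBound S W sp' (Real.exp 1 * 9 * 64 * K₀ 64 8 ^ 2 * A / ρ) r₁ :=
  termDerivBound_of_termBound118 S W sp sp' hρ hmargin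
    (termAnalytic_of_bound238_four F K S W Wk sp hW hsp hrestr han h238 hA hr₁ hrate hsmall)
    (termBound118_of_bound238_four F K S W Wk sp hW hsp hrestr han h238 hA hr₁ hrate hsmall)

open Classical in
/-- **`T4OutputRate.DecayBound` OF THE W1 FUNCTIONAL READ THROUGH `emb` FROM THE H-LAYER DATUM** ([I] (0.25) ∕ (1.18), the real-side binder the N18 ∕
N19 ∕ N22 statements read): n22-c's `YMDAG.N22.W1.decayBound_functionalOn_of_termBound118` — readings inside the spaces (`hemb`) + `TermBound118` ⟹
`DecayBound (W1.functionalOn S p emb) (Window γ) E₀ r₁` — with (1.18) produced by §3 on the window `]0, γ]` (`Wk k = box γ k`). [folklore] -/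
theorem decayBound_functionalOn_of_bound238_four (S : ClusterTower (F.P K) 𝔸 M) (p : RunPairing) {B : Type}
    (emb : B → CPair (F.P K) 𝔸) (sp : (j : ℕ) → (domSys (F.P K) M j).Dom → Set (CPair (F.P K) 𝔸)) {γ A R r₁ : ℝ}
    (hemb : ∀ (j : ℕ) (U : B) (Y : (domSys (F.P K) M j).Dom), emb U ∈ sp j Y)
    (hsp : ∀ (k : ℕ) (X : (domSys (F.P K) M (k + 1)).Dom), IsOpen (sp (k + 1) X)) (hrestr : ∀ k, W1.SpRestr (sp (k + 1)))
    (han : ∀ k, (S k).AnalyticH (box γ k) (sp (k + 1))) (h238 : ∀ k, (S k).Bound238 (box γ k) (sp (k + 1)) A R) (hA : 0 ≤ A)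
    (hr₁ : 0 ≤ r₁) (hrate : r₁ + 2 * (64 * Real.log 162) + 2 ≤ R) (hsmall : A * Real.exp (5 * r₁ + 1) * K₀ 64 8 * 9 * 64 ≤ 1) :
    DecayBound (functionalOn S p emb) (Window γ) (Real.exp 1 * 9 * 64 * K₀ 64 8 ^ 2 * A) r₁ :=
  decayBound_functionalOn_of_termBound118 S p emb sp hemb
    (termBound118_of_bound238_four F K S (Window γ) (fun k => box γ k) sp (fun k _ hg => restrictPrefix_mem_box hg k) hsp hrestr
      han h238 hA hr₁ hrate hsmall)

end IntoN22

/-! ## §5 AT THE W1 READING's LEVEL PAIRING: `DecayBound` of `R.EA S` and of `R.EB S′ b` = NE5's leaves L05 ∕ L06 at the reading -/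

section Reading

/-- Prepending run `k+1`'s unpaired first coupling `b ∈ ]0, γ]` to a window history keeps it in the window `]0, γ]^ℕ`. [folklore] -/
theorem prependCoupling_mem_window {γ b : ℝ} (hb : b ∈ Ioc (0 : ℝ) γ) {g : ℕ → ℝ} (hg : g ∈ Window γ) :
    prependCoupling b g ∈ Window γ := by
  intro i
  cases i with
  | zero => exact hb
  | succ i => exact hg i

variable {F : T4Family} {𝔸 : Type*} [NormedRing 𝔸] [NormedAlgebra ℂ 𝔸] {M k : ℕ} (R : LevelPairing F 𝔸 M k)

open Classical in
/-- **L05 AT THE READING — `DecayBound (R.EA S) (Window γ) E₀ r₁` FROM RUN A's H-LAYER DATA.**  For the level-`k` pairing `R` of the W1 reading and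
run A's tower `S` (the run of `k` steps on `F.P k`): per-step `AnalyticH` + `Bound238` of `S` on an open space table `sp` with the restriction
property, the run-A readings landing inside it (`hembA : R.embA U ∈ sp j X` — [I] p. 263 «the configurations … restricted to X belong to U^c_j»,
DISPLAYED), and the two located clauses ⟹ `|Re E^{(j)}(X; g; embA U)| ≤ E₀·e^{−r₁ d_j(X)}` for every window history: `T4OutputRate.DecayBound
(R.EA S) (Window γ) (e·9·64·K₀(64,8)²·A) r₁` — the leaf `LeafIndex.L05` (an `abbrev` of `DecayBound`) at the reading's run-A functional
(`R.EA S = W1.functionalOn S R.toRunPairing R.embA`, `LevelPairing.EA_eq`). [folklore] -/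
theorem decayBound_EA_of_bound238 (S : ClusterTower (F.P k) 𝔸 M)
    (sp : (j : ℕ) → (domSys (F.P k) M j).Dom → Set (CPair (F.P k) 𝔸)) {γ A Rr r₁ : ℝ}
    (hembA : ∀ (j : ℕ) (U : R.BgA) (X : (domSys (F.P k) M j).Dom), R.embA U ∈ sp j X)
    (hsp : ∀ (m : ℕ) (X : (domSys (F.P k) M (m + 1)).Dom), IsOpen (sp (m + 1) X)) (hrestr : ∀ m, W1.SpRestr (sp (m + 1)))
    (han : ∀ m, (S m).AnalyticH (box γ m) (sp (m + 1))) (h238 : ∀ m, (S m).Bound238 (box γ m) (sp (m + 1)) A Rr) (hA : 0 ≤ A)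
    (hr₁ : 0 ≤ r₁) (hrate : r₁ + 2 * (64 * Real.log 162) + 2 ≤ Rr) (hsmall : A * Real.exp (5 * r₁ + 1) * K₀ 64 8 * 9 * 64 ≤ 1) :
    DecayBound (R.EA S) (Window γ) (Real.exp 1 * 9 * 64 * K₀ 64 8 ^ 2 * A) r₁ :=
  decayBound_functionalOn_of_bound238_four F k S R.toRunPairing R.embA sp hembA hsp hrestr han h238 hA hr₁ hrate hsmall

open Classical in
/-- **L06 AT THE READING — `DecayBound (R.EB S′ b) (Window γ) E₀ r₁` FROM RUN B's H-LAYER DATA**, for every member `b ∈ ]0, γ]` of run B's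
first-coupling family.  For run B's tower `S′` (the run of `k+1` steps on `F.P (k+1)`): per-step `AnalyticH` + `Bound238` of `S′` on an open table
`sp′` with the restriction property, the run-B readings landing inside it (`hembB`), the two located clauses, and the UNPRINTED pairing datum «the
domain pairing does not shrink the linear size: `d_j(X) ≤ d(pair X)`» (`hpair`, DISPLAYED — the record intends equal physical extent, [I]
(0.24)–(0.25); nothing about `R.pair` is assumed elsewhere) ⟹ `|Re E_B(pair X; b∷g; embB U)| ≤ E₀·e^{−r₁ d_j(X)}` for every window history (`b∷g ∈
]0, γ]^ℕ` by `prependCoupling_mem_window`): the leaf `LeafIndex.L06` at the reading's run-B family (`LevelPairing.EB_apply`). [folklore] -/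
theorem decayBound_EB_of_bound238 (S' : ClusterTower (F.P (k + 1)) 𝔸 M)
    (sp' : (j : ℕ) → (domSys (F.P (k + 1)) M j).Dom → Set (CPair (F.P (k + 1)) 𝔸)) {γ A Rr r₁ : ℝ}
    (hembB : ∀ (j : ℕ) (U : R.BgB) (Y : (domSys (F.P (k + 1)) M j).Dom), R.embB U ∈ sp' j Y)
    (hpair : ∀ X : W1.Dom (F.P k) M,
      (domSys (F.P k) M X.1).dj X.2 ≤ (domSys (F.P (k + 1)) M (R.pair X).1).dj (R.pair X).2)
    (hsp : ∀ (m : ℕ) (Y : (domSys (F.P (k + 1)) M (m + 1)).Dom), IsOpen (sp' (m + 1) Y))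
    (hrestr : ∀ m, W1.SpRestr (sp' (m + 1))) (han : ∀ m, (S' m).AnalyticH (box γ m) (sp' (m + 1)))
    (h238 : ∀ m, (S' m).Bound238 (box γ m) (sp' (m + 1)) A Rr) (hA : 0 ≤ A) (hr₁ : 0 ≤ r₁)
    (hrate : r₁ + 2 * (64 * Real.log 162) + 2 ≤ Rr) (hsmall : A * Real.exp (5 * r₁ + 1) * K₀ 64 8 * 9 * 64 ≤ 1) {b : ℝ}
    (hb : b ∈ Ioc (0 : ℝ) γ) :
    DecayBound (R.EB S' b) (Window γ) (Real.exp 1 * 9 * 64 * K₀ 64 8 ^ 2 * A) r₁ := by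
  have h118 := termBound118_of_bound238_four F (k + 1) S' (Window γ) (fun m => box γ m) sp'
    (fun m _ hg => restrictPrefix_mem_box hg m) hsp hrestr han h238 hA hr₁ hrate hsmall
  have hE₀ : 0 ≤ Real.exp 1 * 9 * 64 * K₀ 64 8 ^ 2 * A := by positivity
  intro g hg U X
  have hbg : prependCoupling b g ∈ Window γ := prependCoupling_mem_window hb hg
  have h := h118 (prependCoupling b g) hbg (R.pair X).1 (R.pair X).2 (R.embB U) (hembB _ U _)
  rw [LevelPairing.EB_apply, LevelPairing.carriers_d]
  calc |(functionalC S' (prependCoupling b g) (R.embB U) (R.pair X)).re|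
      ≤ ‖functionalC S' (prependCoupling b g) (R.embB U) (R.pair X)‖ := Complex.abs_re_le_norm _
    _ ≤ Real.exp 1 * 9 * 64 * K₀ 64 8 ^ 2 * A * Real.exp (-(r₁ * (domSys (F.P (k + 1)) M (R.pair X).1).dj (R.pair X).2)) := h
    _ ≤ Real.exp 1 * 9 * 64 * K₀ 64 8 ^ 2 * A * Real.exp (-(r₁ * (domSys (F.P k) M X.1).dj X.2)) :=
        mul_le_mul_of_nonneg_left (Real.exp_le_exp.2 (neg_le_neg (mul_le_mul_of_nonneg_left (hpair X) hr₁))) hE₀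

end Reading

/-! ## §6 A5 rider: the per-step hypotheses are satisfiable (junk witness — W1's termless tower, labelled so) -/

section Rider

variable {P : Params} {𝔸 : Type*} [NormedRing 𝔸] [NormedAlgebra ℂ 𝔸] {M : ℕ}

/-- The termless step (`idx Z = ∅`, `H ≡ 0`; `RateRecordW1Reading` §6) is analytic on any table — `AnalyticH` is satisfiable.  A MODEL tower, NOT
NODE 00's (ref-H WATCH-W1-DEGENERATE: content lives only in towers pinned to the (2.14) terms of record). [folklore] -/
theorem analyticH_termlessTower (k : ℕ) (Wk : Set (Fin (k + 1) → ℝ)) (sp : (domSys P M (k + 1)).Dom → Set (CPair P 𝔸)) :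
    (termlessTower P 𝔸 M k).AnalyticH Wk sp := by
  intro g _ Z
  have h : (fun φ : CPair P 𝔸 => (termlessTower P 𝔸 M k).H g φ Z) = fun _ => 0 := funext fun φ => H_termlessTower k g φ Z
  rw [h]
  exact analyticOnNhd_const

omit [NormedRing 𝔸] [NormedAlgebra ℂ 𝔸] in
/-- The termless step obeys (2.38) with every amplitude `A ≥ 0` and every rate — `Bound238` is satisfiable. [folklore] -/
theorem bound238_termlessTower (k : ℕ) (Wk : Set (Fin (k + 1) → ℝ)) (sp : (domSys P M (k + 1)).Dom → Set (CPair P 𝔸)) {A R : ℝ}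
    (hA : 0 ≤ A) : (termlessTower P 𝔸 M k).Bound238 Wk sp A R := by
  intro g _ Z φ _
  rw [H_termlessTower, norm_zero]
  positivity

end Rider

end Summit.QuantumFields.YangMills.BalabanUVNodes.N18HLayerW1Config

end
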